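import Summits.Ventures.LatticeQCDFlow.Exactness.IMHAnyStartMSE
import Summits.Ventures.LatticeQCDFlow.Exactness.IMHAnyStartBurnIn
import HarnessLib

/-!
# Many short runs of flow-MCMC from ARBITRARY starts: the grand mean of `R` independent exact samplers, `b` updates
# discarded and `N` kept each, has `E(Ȳ − π f)² ≤ [(1 − r^b)·MSE_π(N) + r^b·D²]/R + (1 − 1/R)·(D·r^b·S_N/N)²`

HONEST FRAMING: exact (Metropolis-corrected) sampling algorithms for lattice gauge theory;
figures of merit are autocorrelation/cost numbers at stated couplings and volumes; no
continuum-physics claim.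

Venture `LatticeQCDFlow` (cell pub-lqcd), topic `Exactness`; FANOUT row 30 (lean-1, GEN-35).  NEW WORK of the
cell, general state space.  `K = indepMH q w` (proposal `q`, normalised weight `w`, `π = w·q`, `w` maximal at
`x₀`, `A = 1/w(x₀)`, `r = 1 − A`, `S_N = Σ_{t<N} r^t`); `a ≤ f ≤ c` measurable, `D = max(π f − a, c − π f)`.
The many-chains protocol of flow-MCMC (independent runs, each from its own start — typically a draw of the
proposal — `b` updates discarded, `N` kept, the window averages pooled) is priced by the Scoring row for a generic
Doeblin chain (`Scoring/ReplicaChains`: per-run bias `2C'/(εN)`, per-run error with `16C'²/(ε²N²)`, rate `1 − ε/2`)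
and by GEN-32 for COLD-started replicas exactly (`Exactness/IMHColdStartReplicas`).  Here: ARBITRARY starts with
the exact constants of GEN-34/35 —

* §1 per run, from every start: **`imh_chain_windowAverage_bias_anyStart_abs_le_sum`** —
  `|E_{μ₀}[A_{N,b}] − π f| ≤ D·r^b·S_N/N` (GEN-34 `IMHAnyStartBurnIn`, the `S_N` kept), and the error
  `E_{μ₀}[(A_{N,b} − π f)²] ≤ (1 − r^b)·MSE_π(N) + r^b·D²` (GEN-35 `IMHAnyStartMSE`).
* §2 **`imh_replicas_anyStart_mse_le`** — on any probability space carrying `R ≥ 1` PAIRWISE INDEPENDENT runs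
  `X_0, …, X_{R−1}`, `X_j` distributed as the flow-MCMC chain from an ARBITRARY initial law `μ_j` (different
  runs may start differently): the grand mean `Ȳ` of the window averages `Y_j = (1/N)Σ_{i<N} f(X_j(b+i))` has
  `E(Ȳ − π f)² ≤ [(1 − r^b)·MSE_π(N) + r^b·D²]/R + (1 − 1/R)·(D·r^b·S_N/N)²` — REPLICATION DIVIDES THE
  FLUCTUATION AND THE START'S SECOND-ORDER TERM `r^b·D²`; ONLY THE SQUARED START-UP BIAS `(D·r^b·S_N/N)²`
  SURVIVES, with `S_N/N ≤ min(1, w(x₀)/N)`.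
* §3 **`imh_replicas_anyStart_mse_le_explicit`** — with the tree's `MSE_π(N) ≤ (2w(x₀) − 1)·Var_π f/N`:
  `E(Ȳ − π f)² ≤ [(2w(x₀) − 1)·Var_π f/N + r^b·D²]/R + (1 − 1/R)·(D·r^b·min(1, w(x₀)/N))²`; and
  (**`…_of_log_le`**) under the burn-in rule `log(1/ε) ≤ b/w(x₀)`:
  `≤ [(2w(x₀) − 1)·Var_π f/N + ε·D²]/R + (1 − 1/R)·(ε·D·min(1, w(x₀)/N))²`.
* §4 **`imh_replicas_anyStart_median`** — MUTUALLY INDEPENDENT runs from arbitrary starts and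
  `4·[(2w(x₀) − 1)·Var_π f/N + r^b·D²] ≤ s²` ⇒ `P(#{j < R : |Y_j − π f| ≥ s} ≥ R/2) ≤ exp(−R/8)`: the sample
  median of the `R` window averages is within `s` of `π f` with probability `≥ 1 − e^{−R/8}`, FROM ANY STARTS
  (the Scoring row's median-of-means amplification with the exact any-start error).

Reading (gauge files `Scaling/AutoregressiveGauge…Replicas`): `R` independent exact gauge samplers started anywhere
(e.g. each from a draw of its own autoregressive proposal), `b` configurations discarded, `N` kept: the pooled
estimate of every bounded observable has mean-square error at most `[(2/A − 1)·Var_π f/N + (1 − A)^b·D²]/R +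
(1 − 1/R)·(D·(1 − A)^b·min(1, (1/A)/N))²`.
NOT CLAIMED: a lower bound for arbitrary starts (GEN-32's floor `(δ·S_N/N)²` is the cold start's); the joint law
of runs sharing proposals or random numbers (pairwise independence is assumed); the between-run error ESTIMATOR;
any number for a concrete weight.  No `sorry`, no new definitions, nothing cited as a fact.
-/

noncomputable section

namespace Summit.Ventures.LatticeQCDFlow.Exactness

open MeasureTheory ProbabilityTheory Function Finset
open scoped ENNReal
open Summit.Ventures.LatticeQCDFlow.Scoring

variable {Ω : Type*} [MeasurableSpace Ω] {q : Measure Ω} [IsProbabilityMeasure q] {w : Ω → ℝ}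

/-! ## §1 Per run, from every start: bias with `S_N`, error with `r^b·D²` -/

/-- **`|E_{μ₀}[A_{N,b}] − π f| ≤ D·r^b·S_N/N`** from every start, `D = max(π f − a, c − π f)`, `N ≥ 1`. [ours,
bookkeeping on GEN-34's `imh_chain_windowAverage_bias_anyStart_mem_Icc`] -/
theorem imh_chain_windowAverage_bias_anyStart_abs_le_sum [Fact (Measurable w)] (hw0 : ∀ y, 0 < w y) {x₀ : Ω}
    (hmax : ∀ y, w y ≤ w x₀) [IsProbabilityMeasure (q.withDensity fun y => ENNReal.ofReal (w y))]
    (μ₀ : Measure Ω) [IsProbabilityMeasure μ₀] {f : Ω → ℝ} (hf : Measurable f) {a c : ℝ}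
    (ha : ∀ x, a ≤ f x) (hc : ∀ x, f x ≤ c) (b : ℕ) {N : ℕ} (hN : N ≠ 0) :
    |∫ x, (∑ i ∈ range N, f (x (b + i))) / N ∂(Kernel.trajMeasure (X := fun _ : ℕ => Ω) μ₀
        (fun n : ℕ => (indepMH q w).comap (fun h : (i : ↥(Finset.Iic n)) → Ω => h ⟨n, Finset.mem_Iic.2 le_rfl⟩)
          (measurable_pi_apply _))) - ∫ x, f x ∂(q.withDensity fun y => ENNReal.ofReal (w y))| ≤
      max (∫ x, f x ∂(q.withDensity fun y => ENNReal.ofReal (w y)) - a)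
          (c - ∫ x, f x ∂(q.withDensity fun y => ENNReal.ofReal (w y))) *
        ((1 - (w x₀)⁻¹) ^ b * ∑ t ∈ range N, (1 - (w x₀)⁻¹) ^ t) / N := by
  obtain ⟨h1, h2⟩ := imh_chain_windowAverage_bias_anyStart_mem_Icc (q := q) hw0 hmax μ₀ hf ha hc b hN
  set m := ∫ x, f x ∂(q.withDensity fun y => ENNReal.ofReal (w y)) with hm
  set G := ((1 - (w x₀)⁻¹) ^ b * ∑ t ∈ range N, (1 - (w x₀)⁻¹) ^ t) / N with hG
  have hNpos : (0 : ℝ) < N := by exact_mod_cast Nat.pos_of_ne_zero hN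
  have hW : 1 ≤ w x₀ := one_le_of_mode (q := q) hmax
  have hr : 0 ≤ 1 - (w x₀)⁻¹ := sub_nonneg.2 (inv_le_one_of_one_le₀ hW)
  have hG0 : 0 ≤ G := div_nonneg (mul_nonneg (pow_nonneg hr b) (sum_nonneg fun t _ => pow_nonneg hr t)) hNpos.le
  have e1 : (a - m) * ((1 - (w x₀)⁻¹) ^ b * ∑ t ∈ range N, (1 - (w x₀)⁻¹) ^ t) / N = (a - m) * G := by
    rw [hG]; ring
  have e2 : (c - m) * ((1 - (w x₀)⁻¹) ^ b * ∑ t ∈ range N, (1 - (w x₀)⁻¹) ^ t) / N = (c - m) * G := by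
    rw [hG]; ring
  rw [e1] at h1
  rw [e2] at h2
  have hlo : -(max (m - a) (c - m) * G) ≤ (a - m) * G := by
    rw [neg_le, neg_mul_eq_neg_mul, neg_sub]
    exact mul_le_mul_of_nonneg_right (le_max_left _ _) hG0
  have hhi : (c - m) * G ≤ max (m - a) (c - m) * G := mul_le_mul_of_nonneg_right (le_max_right _ _) hG0
  rw [show max (m - a) (c - m) * ((1 - (w x₀)⁻¹) ^ b * ∑ t ∈ range N, (1 - (w x₀)⁻¹) ^ t) / N =
    max (m - a) (c - m) * G by rw [hG]; ring, abs_le]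
  constructor <;> linarith

/-! ## §2 The grand mean of pairwise independent runs from arbitrary starts -/

section Replicas

variable {Ω' : Type*} {mΩ' : MeasurableSpace Ω'} {μ : Measure Ω'} [IsProbabilityMeasure μ]
  {X : ℕ → Ω' → (ℕ → Ω)} {μ₀ : ℕ → Measure Ω} [∀ j, IsProbabilityMeasure (μ₀ j)] {R : ℕ}

omit [IsProbabilityMeasure q] in
/-- The window average `x ↦ (1/N)Σ_{i<N} f(x(b+i))` is measurable on path space. [ours, bookkeeping] -/
theorem measurable_windowAverage {f : Ω → ℝ} (hf : Measurable f) (b N : ℕ) :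
    Measurable fun x : ℕ → Ω => (∑ i ∈ range N, f (x (b + i))) / N :=
  (Finset.measurable_sum _ fun i _ => hf.comp (measurable_pi_apply (b + i))).div_const _

omit [IsProbabilityMeasure q] [∀ j, IsProbabilityMeasure (μ₀ j)] in
/-- A replica window average of `a ≤ f ≤ c` is square integrable. [ours, bookkeeping] -/
theorem memLp_replica_windowAverage {f : Ω → ℝ} (hf : Measurable f) {a c : ℝ} (ha : ∀ x, a ≤ f x)
    (hc : ∀ x, f x ≤ c) (b : ℕ) {N : ℕ} (hN : N ≠ 0) (hXm : ∀ j, Measurable (X j)) (j : ℕ) :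
    MemLp (fun ω => (∑ i ∈ range N, f (X j ω (b + i))) / N) 2 μ :=
  MemLp.of_bound (((measurable_windowAverage hf b N).comp (hXm j)).aestronglyMeasurable) (max |a| |c|)
    (ae_of_all _ fun ω => by
      rw [Real.norm_eq_abs]
      obtain ⟨h1, h2⟩ := timeAverage_mem_Icc ha hc hN (X j ω) b
      exact abs_le_max_abs_abs h1 h2)

/-- **MANY SHORT RUNS FROM ARBITRARY STARTS.**  `w` measurable (a `Fact`), positive, normalised, maximal at `x₀`;
`r = 1 − 1/w(x₀)`, `S_N = Σ_{t<N} r^t`; `a ≤ f ≤ c` measurable, `D = max(π f − a, c − π f)`; `N ≥ 1`, `R ≥ 1`.  On a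
probability space carrying pairwise independent runs `X_0, …, X_{R−1}`, `X_j` distributed as the flow-MCMC chain from
an arbitrary initial law `μ_j`, the grand mean `Ȳ` of the window averages `Y_j = (1/N)Σ_{i<N} f(X_j(b+i))` has
`E(Ȳ − π f)² ≤ [(1 − r^b)·MSE_π(N) + r^b·D²]/R + (1 − 1/R)·(D·r^b·S_N/N)²`. [ours] -/
theorem imh_replicas_anyStart_mse_le [Fact (Measurable w)] (hw0 : ∀ y, 0 < w y) {x₀ : Ω}
    (hmax : ∀ y, w y ≤ w x₀) [IsProbabilityMeasure (q.withDensity fun y => ENNReal.ofReal (w y))]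
    {f : Ω → ℝ} (hf : Measurable f) {a c : ℝ} (ha : ∀ x, a ≤ f x) (hc : ∀ x, f x ≤ c) (b : ℕ) {N : ℕ}
    (hN : N ≠ 0) (hR : R ≠ 0) (hXm : ∀ j, Measurable (X j))
    (hlaw : ∀ j < R, μ.map (X j) = Kernel.trajMeasure (X := fun _ : ℕ => Ω) (μ₀ j)
      (fun n : ℕ => (indepMH q w).comap (fun h : (i : ↥(Finset.Iic n)) → Ω => h ⟨n, Finset.mem_Iic.2 le_rfl⟩)
        (measurable_pi_apply _)))
    (hind : ∀ i < R, ∀ j < R, i ≠ j → IndepFun (X i) (X j) μ) :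
    ∫ ω, (replicaMean (fun j ω => (∑ i ∈ range N, f (X j ω (b + i))) / N) R ω -
        ∫ z, f z ∂(q.withDensity fun y => ENNReal.ofReal (w y))) ^ 2 ∂μ ≤
      ((1 - (1 - (w x₀)⁻¹) ^ b) *
            ∫ x, ((∑ i ∈ range N, f (x i)) / N - ∫ z, f z ∂(q.withDensity fun y => ENNReal.ofReal (w y))) ^ 2
              ∂(Kernel.trajMeasure (X := fun _ : ℕ => Ω) (q.withDensity fun y => ENNReal.ofReal (w y))
                (fun n : ℕ => (indepMH q w).comap (fun h : (i : ↥(Finset.Iic n)) → Ω => h ⟨n, Finset.mem_Iic.2 le_rfl⟩)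
                  (measurable_pi_apply _))) +
          (1 - (w x₀)⁻¹) ^ b *
            (max (∫ z, f z ∂(q.withDensity fun y => ENNReal.ofReal (w y)) - a)
              (c - ∫ z, f z ∂(q.withDensity fun y => ENNReal.ofReal (w y)))) ^ 2) / R +
        (1 - 1 / R) *
          (max (∫ z, f z ∂(q.withDensity fun y => ENNReal.ofReal (w y)) - a)
              (c - ∫ z, f z ∂(q.withDensity fun y => ENNReal.ofReal (w y))) *
            ((1 - (w x₀)⁻¹) ^ b * ∑ t ∈ range N, (1 - (w x₀)⁻¹) ^ t) / N) ^ 2 := by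
  set m := ∫ z, f z ∂(q.withDensity fun y => ENNReal.ofReal (w y)) with hm
  have hAm : Measurable fun x : ℕ → Ω => (∑ i ∈ range N, f (x (b + i))) / N := measurable_windowAverage hf b N
  have hY2 : ∀ j < R, MemLp (fun ω => (∑ i ∈ range N, f (X j ω (b + i))) / N) 2 μ :=
    fun j _ => memLp_replica_windowAverage hf ha hc b hN hXm j
  have hb : ∀ j < R, |μ[fun ω => (∑ i ∈ range N, f (X j ω (b + i))) / N] - m| ≤
      max (m - a) (c - m) * ((1 - (w x₀)⁻¹) ^ b * ∑ t ∈ range N, (1 - (w x₀)⁻¹) ^ t) / N := by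
    intro j hj
    have h := integral_comp_eq_of_map_eq (hXm j) (hlaw j hj) hAm
    rw [show μ[fun ω => (∑ i ∈ range N, f (X j ω (b + i))) / N] =
        ∫ ω, (∑ i ∈ range N, f (X j ω (b + i))) / N ∂μ from rfl, h]
    exact imh_chain_windowAverage_bias_anyStart_abs_le_sum (q := q) hw0 hmax (μ₀ j) hf ha hc b hN
  have hv : ∀ j < R, ∫ ω, ((∑ i ∈ range N, f (X j ω (b + i))) / N - m) ^ 2 ∂μ ≤
      (1 - (1 - (w x₀)⁻¹) ^ b) *
          ∫ x, ((∑ i ∈ range N, f (x i)) / N - m) ^ 2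
            ∂(Kernel.trajMeasure (X := fun _ : ℕ => Ω) (q.withDensity fun y => ENNReal.ofReal (w y))
              (fun n : ℕ => (indepMH q w).comap (fun h : (i : ↥(Finset.Iic n)) → Ω => h ⟨n, Finset.mem_Iic.2 le_rfl⟩)
                (measurable_pi_apply _))) +
        (1 - (w x₀)⁻¹) ^ b * (max (m - a) (c - m)) ^ 2 := by
    intro j hj
    have h := integral_comp_eq_of_map_eq (hXm j) (hlaw j hj)
      (φ := fun x : ℕ → Ω => ((∑ i ∈ range N, f (x (b + i))) / N - m) ^ 2) ((hAm.sub measurable_const).pow_const 2)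
    rw [h]
    exact imh_chain_windowMSE_anyStart_le (q := q) hw0 hmax (μ₀ j) hf ha hc b hN
  have hcov : ∀ i < R, ∀ j < R, i ≠ j →
      cov[fun ω => (∑ k ∈ range N, f (X i ω (b + k))) / N, fun ω => (∑ k ∈ range N, f (X j ω (b + k))) / N; μ] = 0 :=
    fun i hi j hj hij => ((hind i hi j hj hij).comp hAm hAm).covariance_eq_zero (hY2 i hi) (hY2 j hj)
  exact integral_replicaMean_sub_sq_le (Y := fun j ω => (∑ i ∈ range N, f (X j ω (b + i))) / N) hR hY2 hcov hb hv

/-! ## §3 Explicitly, with the equilibrium certificate and `S_N/N ≤ min(1, w(x₀)/N)` -/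

/-- **`E(Ȳ − π f)² ≤ [(2w(x₀) − 1)·Var_π f/N + r^b·D²]/R + (1 − 1/R)·(D·r^b·min(1, w(x₀)/N))²`** for pairwise
independent runs from arbitrary starts (`N ≥ 1`, `R ≥ 1`). [ours] -/
theorem imh_replicas_anyStart_mse_le_explicit [Fact (Measurable w)] (hw0 : ∀ y, 0 < w y) {x₀ : Ω}
    (hmax : ∀ y, w y ≤ w x₀) [IsProbabilityMeasure (q.withDensity fun y => ENNReal.ofReal (w y))]
    {f : Ω → ℝ} (hf : Measurable f) {a c : ℝ} (ha : ∀ x, a ≤ f x) (hc : ∀ x, f x ≤ c) (b : ℕ) {N : ℕ}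
    (hN : N ≠ 0) (hR : R ≠ 0) (hXm : ∀ j, Measurable (X j))
    (hlaw : ∀ j < R, μ.map (X j) = Kernel.trajMeasure (X := fun _ : ℕ => Ω) (μ₀ j)
      (fun n : ℕ => (indepMH q w).comap (fun h : (i : ↥(Finset.Iic n)) → Ω => h ⟨n, Finset.mem_Iic.2 le_rfl⟩)
        (measurable_pi_apply _)))
    (hind : ∀ i < R, ∀ j < R, i ≠ j → IndepFun (X i) (X j) μ) :
    ∫ ω, (replicaMean (fun j ω => (∑ i ∈ range N, f (X j ω (b + i))) / N) R ω -
        ∫ z, f z ∂(q.withDensity fun y => ENNReal.ofReal (w y))) ^ 2 ∂μ ≤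
      ((2 * w x₀ - 1) *
            (∫ x, (f x - ∫ z, f z ∂(q.withDensity fun y => ENNReal.ofReal (w y))) ^ 2
              ∂(q.withDensity fun y => ENNReal.ofReal (w y))) / N +
          (1 - (w x₀)⁻¹) ^ b *
            (max (∫ z, f z ∂(q.withDensity fun y => ENNReal.ofReal (w y)) - a)
              (c - ∫ z, f z ∂(q.withDensity fun y => ENNReal.ofReal (w y)))) ^ 2) / R +
        (1 - 1 / R) *
          (max (∫ z, f z ∂(q.withDensity fun y => ENNReal.ofReal (w y)) - a)
              (c - ∫ z, f z ∂(q.withDensity fun y => ENNReal.ofReal (w y))) *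
            ((1 - (w x₀)⁻¹) ^ b * min 1 (w x₀ / N))) ^ 2 := by
  have h1 := imh_replicas_anyStart_mse_le (q := q) hw0 hmax hf ha hc b hN hR hXm hlaw hind
  set m := ∫ z, f z ∂(q.withDensity fun y => ENNReal.ofReal (w y)) with hm
  have hC : ∀ x, |f x| ≤ max |a| |c| := fun x => abs_le_max_abs_abs (ha x) (hc x)
  have h2 := imh_chain_mse_stationary_le (q := q) hw0 hmax hf hC hN (x₀ := x₀)
  have hM0 := imh_chain_windowMSE_anyStart_ge (q := q) hw0 hmax (q.withDensity fun y => ENNReal.ofReal (w y)) hf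
    ha hc 0 hN
  simp only [pow_zero, sub_self, zero_mul, zero_add] at hM0
  have hNpos : (0 : ℝ) < N := by exact_mod_cast Nat.pos_of_ne_zero hN
  have hRpos : (0 : ℝ) < R := by exact_mod_cast Nat.pos_of_ne_zero hR
  have hW : 1 ≤ w x₀ := one_le_of_mode (q := q) hmax
  have hr : 0 ≤ 1 - (w x₀)⁻¹ := sub_nonneg.2 (inv_le_one_of_one_le₀ hW)
  have hr1 : 1 - (w x₀)⁻¹ ≤ 1 := sub_le_self _ (inv_nonneg.mpr (hw0 x₀).le)
  have hrb : 0 ≤ (1 - (w x₀)⁻¹) ^ b := pow_nonneg hr b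
  have hc0 : 0 ≤ 1 - (1 - (w x₀)⁻¹) ^ b := sub_nonneg.2 (pow_le_one₀ hr hr1)
  have hc1 : 1 - (1 - (w x₀)⁻¹) ^ b ≤ 1 := sub_le_self _ hrb
  have hD0 : 0 ≤ max (m - a) (c - m) := by
    have := (ha x₀).trans (hc x₀)
    rcases le_total m a with h | h
    · exact le_max_of_le_right (by linarith)
    · exact le_max_of_le_left (by linarith)
  have hR1 : 0 ≤ 1 - 1 / (R : ℝ) := by
    rw [sub_nonneg, div_le_one hRpos]; exact_mod_cast Nat.one_le_iff_ne_zero.2 hR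
  -- `S_N/N ≤ min(1, w(x₀)/N)`
  have hSN : (∑ t ∈ range N, (1 - (w x₀)⁻¹) ^ t) / N ≤ min 1 (w x₀ / N) := by
    refine le_min ?_ ?_
    · rw [div_le_one hNpos]; exact geom_sum_mode_le_card (q := q) hw0 hmax N
    · exact div_le_div_of_nonneg_right (geom_sum_mode_le_weight (q := q) hw0 hmax N) hNpos.le
  have hS0 : 0 ≤ (∑ t ∈ range N, (1 - (w x₀)⁻¹) ^ t) / N :=
    div_nonneg (sum_nonneg fun t _ => pow_nonneg hr t) hNpos.le
  -- the variance part
  have hvar : (1 - (1 - (w x₀)⁻¹) ^ b) *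
      ∫ x, ((∑ i ∈ range N, f (x i)) / N - m) ^ 2
        ∂(Kernel.trajMeasure (X := fun _ : ℕ => Ω) (q.withDensity fun y => ENNReal.ofReal (w y))
          (fun n : ℕ => (indepMH q w).comap (fun h : (i : ↥(Finset.Iic n)) → Ω => h ⟨n, Finset.mem_Iic.2 le_rfl⟩)
            (measurable_pi_apply _))) ≤
      (2 * w x₀ - 1) * (∫ x, (f x - m) ^ 2 ∂(q.withDensity fun y => ENNReal.ofReal (w y))) / N :=
    (mul_le_of_le_one_left hM0 hc1).trans h2
  -- the bias part
  have hbias : max (m - a) (c - m) * ((1 - (w x₀)⁻¹) ^ b * ∑ t ∈ range N, (1 - (w x₀)⁻¹) ^ t) / N ≤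
      max (m - a) (c - m) * ((1 - (w x₀)⁻¹) ^ b * min 1 (w x₀ / N)) := by
    rw [show max (m - a) (c - m) * ((1 - (w x₀)⁻¹) ^ b * ∑ t ∈ range N, (1 - (w x₀)⁻¹) ^ t) / N =
      max (m - a) (c - m) * ((1 - (w x₀)⁻¹) ^ b * ((∑ t ∈ range N, (1 - (w x₀)⁻¹) ^ t) / N)) by ring]
    exact mul_le_mul_of_nonneg_left (mul_le_mul_of_nonneg_left hSN hrb) hD0
  have hbias0 : 0 ≤ max (m - a) (c - m) * ((1 - (w x₀)⁻¹) ^ b * ∑ t ∈ range N, (1 - (w x₀)⁻¹) ^ t) / N :=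
    div_nonneg (mul_nonneg hD0 (mul_nonneg hrb (sum_nonneg fun t _ => pow_nonneg hr t))) hNpos.le
  have hsq := pow_le_pow_left₀ hbias0 hbias 2
  have hdiv := div_le_div_of_nonneg_right
    (add_le_add hvar (le_refl ((1 - (w x₀)⁻¹) ^ b * (max (m - a) (c - m)) ^ 2))) hRpos.le
  have hmul := mul_le_mul_of_nonneg_left hsq hR1
  linarith

/-- **With the burn-in rule** `log(1/ε) ≤ b/w(x₀)`:
`E(Ȳ − π f)² ≤ [(2w(x₀) − 1)·Var_π f/N + ε·D²]/R + (1 − 1/R)·(ε·D·min(1, w(x₀)/N))²`. [ours] -/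
theorem imh_replicas_anyStart_mse_le_explicit_of_log_le [Fact (Measurable w)] (hw0 : ∀ y, 0 < w y) {x₀ : Ω}
    (hmax : ∀ y, w y ≤ w x₀) [IsProbabilityMeasure (q.withDensity fun y => ENNReal.ofReal (w y))]
    {f : Ω → ℝ} (hf : Measurable f) {a c : ℝ} (ha : ∀ x, a ≤ f x) (hc : ∀ x, f x ≤ c) {b : ℕ} {N : ℕ}
    (hN : N ≠ 0) (hR : R ≠ 0) (hXm : ∀ j, Measurable (X j))
    (hlaw : ∀ j < R, μ.map (X j) = Kernel.trajMeasure (X := fun _ : ℕ => Ω) (μ₀ j)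
      (fun n : ℕ => (indepMH q w).comap (fun h : (i : ↥(Finset.Iic n)) → Ω => h ⟨n, Finset.mem_Iic.2 le_rfl⟩)
        (measurable_pi_apply _)))
    (hind : ∀ i < R, ∀ j < R, i ≠ j → IndepFun (X i) (X j) μ) {ε : ℝ} (hε : 0 < ε)
    (hb : Real.log (1 / ε) ≤ b * (w x₀)⁻¹) :
    ∫ ω, (replicaMean (fun j ω => (∑ i ∈ range N, f (X j ω (b + i))) / N) R ω -
        ∫ z, f z ∂(q.withDensity fun y => ENNReal.ofReal (w y))) ^ 2 ∂μ ≤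
      ((2 * w x₀ - 1) *
            (∫ x, (f x - ∫ z, f z ∂(q.withDensity fun y => ENNReal.ofReal (w y))) ^ 2
              ∂(q.withDensity fun y => ENNReal.ofReal (w y))) / N +
          ε * (max (∫ z, f z ∂(q.withDensity fun y => ENNReal.ofReal (w y)) - a)
              (c - ∫ z, f z ∂(q.withDensity fun y => ENNReal.ofReal (w y)))) ^ 2) / R +
        (1 - 1 / R) *
          (max (∫ z, f z ∂(q.withDensity fun y => ENNReal.ofReal (w y)) - a)
              (c - ∫ z, f z ∂(q.withDensity fun y => ENNReal.ofReal (w y))) *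
            (ε * min 1 (w x₀ / N))) ^ 2 := by
  have h1 := imh_replicas_anyStart_mse_le_explicit (q := q) hw0 hmax hf ha hc b hN hR hXm hlaw hind
  set m := ∫ z, f z ∂(q.withDensity fun y => ENNReal.ofReal (w y)) with hm
  have hεb : (1 - (w x₀)⁻¹) ^ b ≤ ε := pow_mode_le_of_log_le (q := q) hmax hε hb
  have hNpos : (0 : ℝ) < N := by exact_mod_cast Nat.pos_of_ne_zero hN
  have hRpos : (0 : ℝ) < R := by exact_mod_cast Nat.pos_of_ne_zero hR
  have hW : 1 ≤ w x₀ := one_le_of_mode (q := q) hmax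
  have hrb : 0 ≤ (1 - (w x₀)⁻¹) ^ b := pow_nonneg (sub_nonneg.2 (inv_le_one_of_one_le₀ hW)) b
  have hD0 : 0 ≤ max (m - a) (c - m) := by
    have := (ha x₀).trans (hc x₀)
    rcases le_total m a with h | h
    · exact le_max_of_le_right (by linarith)
    · exact le_max_of_le_left (by linarith)
  have hR1 : 0 ≤ 1 - 1 / (R : ℝ) := by
    rw [sub_nonneg, div_le_one hRpos]; exact_mod_cast Nat.one_le_iff_ne_zero.2 hR
  have hmin0 : 0 ≤ min 1 (w x₀ / N) := le_min zero_le_one (div_nonneg (hw0 x₀).le hNpos.le)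
  have hb1 : max (m - a) (c - m) * ((1 - (w x₀)⁻¹) ^ b * min 1 (w x₀ / N)) ≤
      max (m - a) (c - m) * (ε * min 1 (w x₀ / N)) :=
    mul_le_mul_of_nonneg_left (mul_le_mul_of_nonneg_right hεb hmin0) hD0
  have hb0 : 0 ≤ max (m - a) (c - m) * ((1 - (w x₀)⁻¹) ^ b * min 1 (w x₀ / N)) :=
    mul_nonneg hD0 (mul_nonneg hrb hmin0)
  have hsq := mul_le_mul_of_nonneg_left (pow_le_pow_left₀ hb0 hb1 2) hR1
  have hv1 := div_le_div_of_nonneg_right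
    (add_le_add (le_refl ((2 * w x₀ - 1) * (∫ x, (f x - m) ^ 2 ∂(q.withDensity fun y => ENNReal.ofReal (w y))) / N))
      (mul_le_mul_of_nonneg_right hεb (sq_nonneg (max (m - a) (c - m))))) hRpos.le
  linarith

/-! ## §4 The median of mutually independent runs from arbitrary starts -/

/-- **MEDIAN OF RUNS FROM ARBITRARY STARTS**: mutually independent runs, `4·[(2w(x₀) − 1)·Var_π f/N + r^b·D²] ≤ s²`
⇒ `P(#{j < R : |Y_j − π f| ≥ s} ≥ R/2) ≤ exp(−R/8)` — on the complement every sample median of the `R` window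
averages is within `s` of `π f`. [ours, the Scoring row's median-of-means step on the exact any-start error] -/
theorem imh_replicas_anyStart_median [Fact (Measurable w)] (hw0 : ∀ y, 0 < w y) {x₀ : Ω}
    (hmax : ∀ y, w y ≤ w x₀) [IsProbabilityMeasure (q.withDensity fun y => ENNReal.ofReal (w y))]
    {f : Ω → ℝ} (hf : Measurable f) {a c : ℝ} (ha : ∀ x, a ≤ f x) (hc : ∀ x, f x ≤ c) (b : ℕ) {N : ℕ}
    (hN : N ≠ 0) (hXm : ∀ j, Measurable (X j))
    (hlaw : ∀ j < R, μ.map (X j) = Kernel.trajMeasure (X := fun _ : ℕ => Ω) (μ₀ j)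
      (fun n : ℕ => (indepMH q w).comap (fun h : (i : ↥(Finset.Iic n)) → Ω => h ⟨n, Finset.mem_Iic.2 le_rfl⟩)
        (measurable_pi_apply _)))
    (hind : iIndepFun X μ) {s : ℝ} (hs : 0 < s)
    (hs2 : 4 * ((2 * w x₀ - 1) *
            (∫ x, (f x - ∫ z, f z ∂(q.withDensity fun y => ENNReal.ofReal (w y))) ^ 2
              ∂(q.withDensity fun y => ENNReal.ofReal (w y))) / N +
          (1 - (w x₀)⁻¹) ^ b *
            (max (∫ z, f z ∂(q.withDensity fun y => ENNReal.ofReal (w y)) - a)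
              (c - ∫ z, f z ∂(q.withDensity fun y => ENNReal.ofReal (w y)))) ^ 2) ≤ s ^ 2) :
    μ.real {ω | (R : ℝ) / 2 ≤ #{j ∈ range R |
        s ≤ |(∑ i ∈ range N, f (X j ω (b + i))) / N - ∫ z, f z ∂(q.withDensity fun y => ENNReal.ofReal (w y))|}} ≤
      Real.exp (-(R / 8)) := by
  set m := ∫ z, f z ∂(q.withDensity fun y => ENNReal.ofReal (w y)) with hm
  have hAm : Measurable fun x : ℕ → Ω => (∑ i ∈ range N, f (x (b + i))) / N := measurable_windowAverage hf b N
  have hYm : ∀ j, Measurable fun ω => (∑ i ∈ range N, f (X j ω (b + i))) / N := fun j => hAm.comp (hXm j)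
  have hY2 : ∀ j < R, MemLp (fun ω => (∑ i ∈ range N, f (X j ω (b + i))) / N) 2 μ :=
    fun j _ => memLp_replica_windowAverage hf ha hc b hN hXm j
  have hYind : iIndepFun (fun j ω => (∑ i ∈ range N, f (X j ω (b + i))) / N) μ :=
    hind.comp (fun _ => fun x : ℕ → Ω => (∑ i ∈ range N, f (x (b + i))) / N) fun _ => hAm
  have hC : ∀ x, |f x| ≤ max |a| |c| := fun x => abs_le_max_abs_abs (ha x) (hc x)
  have hv : ∀ j < R, ∫ ω, ((∑ i ∈ range N, f (X j ω (b + i))) / N - m) ^ 2 ∂μ ≤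
      (2 * w x₀ - 1) * (∫ x, (f x - m) ^ 2 ∂(q.withDensity fun y => ENNReal.ofReal (w y))) / N +
        (1 - (w x₀)⁻¹) ^ b * (max (m - a) (c - m)) ^ 2 := by
    intro j hj
    have h := integral_comp_eq_of_map_eq (hXm j) (hlaw j hj)
      (φ := fun x : ℕ → Ω => ((∑ i ∈ range N, f (x (b + i))) / N - m) ^ 2) ((hAm.sub measurable_const).pow_const 2)
    rw [h]
    exact imh_chain_windowMSE_anyStart_le_explicit (q := q) hw0 hmax (μ₀ j) hf ha hc b hN
  exact measureReal_half_replicas_far_le_of_sq hYind hYm hY2 hs hs2 hv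

end Replicas

end Summit.Ventures.LatticeQCDFlow.Exactness
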